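import Mathlib.RingTheory.MvPolynomial.WeightedHomogeneous
import Mathlib.Algebra.MvPolynomial.PDeriv
import Mathlib.Algebra.Polynomial.Derivation
import Mathlib.Algebra.MvPolynomial.Equiv
import Literature.NumberTheory.Automorphic.BigCellReduction
import Literature.NumberTheory.Automorphic.ReductiveDualRootDatum
import HarnessLib

/-!
# Products of root homomorphisms have polynomial left inverses (Springer 8.2.1, injectivity half)
(trunk T-AUTOMORPHIC, G25 AutomorphicL)

Companion to `BigCellReduction.lean` (namespace `Literature.Automorphic`). There the named fact
`posRootGroup_prodIso` transcribes Springer, *Linear Algebraic Groups* (2nd ed.), 8.2.1: for a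
numbering `(α_i)_{i ∈ l}` of a system of positive roots `R⁺(y)`, *the morphism
`φ : 𝔾ₐ^m → B_u`, `φ(x) = ∏ u_{α_i}(x_i)`, is an isomorphism of varieties*, rendered as
(a) `φ` maps onto `U(y) = ⟨u_i(𝔾ₐ)⟩` and (b) `φ` has a polynomial left inverse. This file
**proves (b)** — for any list of distinct roots positive on a coweight `y`, in any order — and so
reduces 8.2.1 to its surjectivity half:

* `exists_mvPolynomial_retraction` (abstract form, proved): let `M_i(x) = 1 + x A_{i,1} + ⋯` be
  matrix polynomials whose `X^d`-coefficients `A_{i,d}` have `(p, q)` entries zero unless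
  `e_p - e_q = d · w_i` for weights `e_p`, `w_i` in an abelian group, with `A_{i,1} ≠ 0`, the
  `w_i` distinct and of positive height under an additive `Λ → ℤ`; then every parameter `x_j` is
  a polynomial in the entries of `∏_{i ∈ l} M_i(x_i)`. (Induction on the height: the entries of
  the product are weighted homogeneous — Mathlib `MvPolynomial.IsWeightedHomogeneous` — so the
  `(p₀, q₀)` entry with `(A_{j,1})_{p₀q₀} ≠ 0` is `(A_{j,1})_{p₀q₀} x_j` plus monomials in
  parameters of strictly smaller height; the linear coefficients of the product are read off
  from `∂_j` at `0`, `coeff_single_one_prodPolyMat`.)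
* `coeff_eq_zero_of_coeff_one_eq_zero` (proved): in characteristic `0`, a polynomial
  one-parameter matrix family with `M(0) = 1`, `M(2x) = M(x)²` and vanishing linear term is
  constant (`(2^d - 2) A_d = ∑_{0<c<d} A_c A_{d-c}`).
* `exists_polyRetraction_prod_rootHom` (proved): for `T` a torus, `P` a root datum of `(G, T)`
  with root homomorphisms `u_i` and distinct roots `(α_i)_{i ∈ l}` positive on `y`, there are
  polynomials `q_i` in the matrix coordinates with `q_i(∏_{j ∈ l} u_j(x_j)) = x_i`. (Diagonalise
  `T` by `A` — `exists_conj_le_diagonalSubgroup`; the torus relation `t u_i(x) t⁻¹ =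
  u_i(α_i(t) x)` makes the `X^d`-coefficient of the `(p, q)` entry of `A u_i(x) A⁻¹` vanish
  unless `α_i^d = χ_p χ_q⁻¹` in `X*(T)`; the linear term is non-zero by the previous lemma and
  the injectivity of `u_i`; the height is `⟨·, λ_y⟩`, additive on `X*(T)` by 3.2.11 (i),
  `charPairingInt_mul_left` of `ReductiveDualRootDatum.lean`.)
* `posRootGroup_eq_prod` (**named fact**, the surjectivity half of 8.2.1: every element of
  `U(y)` is an ordered product `∏_{i ∈ l} u_i(x_i)`), `posRootGroup_prodIso_of_eq_prod`
  (proved: it implies `posRootGroup_prodIso`), `nonempty_bigCellChart_of_eq_prod` and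
  `Literature.NumberTheory.Automorphic.chevalley_isomorphism_of_eq_prod` (proved):
  `chevalley_isomorphism_abstract → posRootGroup_eq_prod (G,T), (G',T') →
  bigCell_nhds_one (G,T), (G',T') → chevalley_isomorphism`.

Remaining DAG for `Literature.Lang.chevalley_isomorphism_holds`: `chevalley_isomorphism_abstract`
(Springer 9.6.2 step 1: 9.4.3, 9.5.4, 8.1.4), `posRootGroup_eq_prod` (8.2.1, surjectivity:
8.2.2–8.2.3 and dimensions) and `bigCell_nhds_one` (8.3.11: Bruhat's lemma 8.3.8, 8.3.5–8.3.6).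

## References

* T. A. Springer, *Linear Algebraic Groups*, 2nd ed., Progress in Mathematics 9, Birkhäuser
  (1998) [SpringerLAG1998]: 2.4.2 (ii), 3.2.11 (i), 7.4.5, 8.1.1 (i), 8.2.1, 8.2.4 (i), 8.3.11,
  and the proof of 9.6.2.
-/

open scoped MatrixGroups IsMulCommutative
open Matrix Polynomial MvPolynomial

noncomputable section

namespace Literature.NumberTheory.Automorphic

/-! ### One-variable polynomials placed at a variable of a multivariable ring -/

section ToMv

variable {k : Type*} [Field k] {ι : Type*}

/-! We use Mathlib's `Polynomial.toMvPolynomial i : k[X] →ₐ[k] MvPolynomial ι k` (`f ↦ f(X_i)`,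
with `MvPolynomial.eval_toMvPolynomial`) and add the few facts about it needed below. -/

/-- `f(X_i)` as a sum of monomials. [folklore] -/
theorem toMvPolynomial_eq_sum (i : ι) (f : k[X]) :
    f.toMvPolynomial i = f.sum fun d a => MvPolynomial.monomial (Finsupp.single i d) a := by
  rw [Polynomial.toMvPolynomial, Polynomial.aeval_def, Polynomial.eval₂_eq_sum]
  refine Finset.sum_congr rfl fun d _ => ?_
  beta_reduce
  rw [MvPolynomial.algebraMap_eq, MvPolynomial.monomial_eq]
  congr 1
  rw [Finsupp.prod_single_index]
  exact pow_zero _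

/-- The constant coefficient of `f(X_i)` is that of `f`. [folklore] -/
@[simp] theorem constantCoeff_toMvPolynomial (i : ι) (f : k[X]) :
    MvPolynomial.constantCoeff (f.toMvPolynomial i) = f.coeff 0 := by
  rw [← MvPolynomial.eval_zero, MvPolynomial.eval_toMvPolynomial, Pi.zero_apply,
    Polynomial.coeff_zero_eq_eval_zero]

/-- The partial derivative of `f(X_i)`: `∂_j f(X_i) = δ_{ij} f'(X_i)` (chain rule). [folklore] -/
theorem pderiv_toMvPolynomial [DecidableEq ι] (i j : ι) (f : k[X]) :
    MvPolynomial.pderiv j (f.toMvPolynomial i) =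
      if i = j then (derivative f).toMvPolynomial i else 0 := by
  change MvPolynomial.pderiv j (Polynomial.aeval (MvPolynomial.X i) f) = _
  rw [Derivation.comp_aeval_eq, MvPolynomial.pderiv_X]
  split_ifs with h
  · subst h
    rw [Pi.single_eq_same, smul_eq_mul, mul_one]
    rfl
  · rw [Pi.single_eq_of_ne h, smul_zero]

end ToMv

/-! ### Matrices of polynomials attached to a list of one-parameter families -/

section PolyMat

variable {k : Type*} [Field k] {ι : Type*} {n : Type*} [Fintype n] [DecidableEq n]

/-- The variables of `f(X_i)` are among `{i}`. [folklore] -/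
theorem vars_toMvPolynomial_subset [DecidableEq ι] (i : ι) (f : k[X]) :
    (f.toMvPolynomial i).vars ⊆ {i} := by
  rw [toMvPolynomial_eq_sum, Polynomial.sum_def]
  refine (MvPolynomial.vars_sum_subset _ _).trans (Finset.biUnion_subset.mpr fun d _ => ?_)
  by_cases h : f.coeff d = 0
  · simp [h]
  · rw [MvPolynomial.vars_monomial h]
    exact Finsupp.support_single_subset

/-- The matrix `M_i(X_i) ∈ Matₙ(k[X_ι])` of the one-parameter family with polynomial entries
`P i`, its parameter being the variable `X_i`. [folklore] -/
def matAt (P : ι → n → n → k[X]) (i : ι) : Matrix n n (MvPolynomial ι k) :=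
  Matrix.of fun p q => (P i p q).toMvPolynomial i

/-- The ordered product `∏_{i ∈ l} M_i(X_i) ∈ Matₙ(k[X_ι])`. [folklore] -/
def prodPolyMat (P : ι → n → n → k[X]) (l : List ι) : Matrix n n (MvPolynomial ι k) :=
  (l.map (matAt P)).prod

/-- The numerical product `∏_{i ∈ l} M_i(x_i)`. [folklore] -/
def prodMat (P : ι → n → n → k[X]) (l : List ι) (x : ι → k) : Matrix n n k :=
  (l.map fun i => Matrix.of fun p q => (P i p q).eval (x i)).prod

/-- Evaluating `∏ M_i(X_i)` at `x` gives `∏ M_i(x_i)`. [folklore] -/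
theorem prodPolyMat_map_eval (P : ι → n → n → k[X]) (l : List ι) (x : ι → k) :
    (prodPolyMat P l).map (MvPolynomial.eval x) = prodMat P l x := by
  rw [prodPolyMat, prodMat, ← RingHom.mapMatrix_apply, map_list_prod, List.map_map]
  congr 1
  refine List.map_congr_left fun i _ => ?_
  ext p q
  simp [matAt]

/-- Entrywise form of `prodPolyMat_map_eval`. [folklore] -/
theorem eval_prodPolyMat (P : ι → n → n → k[X]) (l : List ι) (x : ι → k) (p q : n) :
    MvPolynomial.eval x (prodPolyMat P l p q) = prodMat P l x p q := by
  rw [← prodPolyMat_map_eval, Matrix.map_apply]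

/-- `prodPolyMat` of a cons. [folklore] -/
theorem prodPolyMat_cons (P : ι → n → n → k[X]) (i : ι) (l : List ι) :
    prodPolyMat P (i :: l) = matAt P i * prodPolyMat P l := by
  rw [prodPolyMat, List.map_cons, List.prod_cons, prodPolyMat]

/-- `prodPolyMat` of the empty list. [folklore] -/
theorem prodPolyMat_nil (P : ι → n → n → k[X]) : prodPolyMat P [] = 1 := by
  rw [prodPolyMat, List.map_nil, List.prod_nil]

/-! #### Variables -/

/-- The entries of `∏_{i ∈ l} M_i(X_i)` only involve the variables `X_i`, `i ∈ l`. [folklore] -/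
theorem vars_prodPolyMat_subset [DecidableEq ι] (P : ι → n → n → k[X]) (l : List ι) (p q : n) :
    (prodPolyMat P l p q).vars ⊆ l.toFinset := by
  induction l generalizing p q with
  | nil =>
    rw [prodPolyMat_nil]
    by_cases h : p = q
    · subst h; simp
    · simp [Matrix.one_apply_ne h]
  | cons i l ih =>
    rw [prodPolyMat_cons, Matrix.mul_apply, List.toFinset_cons]
    refine (MvPolynomial.vars_sum_subset _ _).trans (Finset.biUnion_subset.mpr fun r _ => ?_)
    refine (MvPolynomial.vars_mul _ _).trans (Finset.union_subset ?_ ((ih r q).trans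
      (Finset.subset_insert _ _)))
    rw [matAt, Matrix.of_apply]
    exact (vars_toMvPolynomial_subset i _).trans
      (Finset.singleton_subset_iff.mpr (Finset.mem_insert_self _ _))

end PolyMat

/-! ### Weighted homogeneity of the entries -/

section Weighted

variable {k : Type*} [Field k] {ι : Type*} {n : Type*} [Fintype n] [DecidableEq n]
variable {Λ : Type*} [AddCommGroup Λ] (w : ι → Λ) (e : n → Λ)

/-- A matrix of polynomials is *`(w, e)`-weighted* if its `(p, q)` entry is weighted homogeneous
of degree `e p - e q` for the weights `w` of the variables (the condition satisfied by a matrix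
commuting with a torus acting with weights `e` on `kⁿ` and `w` on the parameters). [folklore] -/
def IsWtMatrix (F : Matrix n n (MvPolynomial ι k)) : Prop :=
  ∀ p q, MvPolynomial.IsWeightedHomogeneous w (F p q) (e p - e q)

variable {w e}

omit [Fintype n] in
/-- The identity matrix is weighted. [folklore] -/
theorem IsWtMatrix.one : IsWtMatrix w e (1 : Matrix n n (MvPolynomial ι k)) := by
  intro p q
  by_cases h : p = q
  · subst h
    rw [Matrix.one_apply_eq, sub_self]
    exact MvPolynomial.isWeightedHomogeneous_one (R := k) w
  · rw [Matrix.one_apply_ne h]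
    exact MvPolynomial.isWeightedHomogeneous_zero (R := k) w _

omit [DecidableEq n] in
/-- Products of weighted matrices are weighted. [folklore] -/
theorem IsWtMatrix.mul {F G : Matrix n n (MvPolynomial ι k)} (hF : IsWtMatrix w e F)
    (hG : IsWtMatrix w e G) : IsWtMatrix w e (F * G) := by
  intro p q
  rw [Matrix.mul_apply]
  refine MvPolynomial.IsWeightedHomogeneous.sum _ _ _ fun r _ => ?_
  have h := (hF p r).mul (hG r q)
  rwa [sub_add_sub_cancel] at h

/-- List products of weighted matrices are weighted. [folklore] -/
theorem IsWtMatrix.list_prod {L : List (Matrix n n (MvPolynomial ι k))}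
    (h : ∀ F ∈ L, IsWtMatrix w e F) : IsWtMatrix w e L.prod := by
  induction L with
  | nil => simpa using (IsWtMatrix.one : IsWtMatrix w e (1 : Matrix n n (MvPolynomial ι k)))
  | cons F L ih =>
    rw [List.prod_cons]
    exact (h F (by simp)).mul (ih fun G hG => h G (by simp [hG]))

omit [Fintype n] [DecidableEq n] in
/-- `M_i(X_i)` is weighted as soon as the coefficient of `X^d` in its `(p, q)` entry vanishes
unless `d · w_i = e_p - e_q`. [folklore] -/
theorem matAt_isWtMatrix (P : ι → n → n → k[X]) (i : ι)
    (hw : ∀ p q d, (P i p q).coeff d ≠ 0 → d • w i = e p - e q) : IsWtMatrix w e (matAt P i) := by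
  intro p q
  rw [matAt, Matrix.of_apply, toMvPolynomial_eq_sum, Polynomial.sum_def]
  refine MvPolynomial.IsWeightedHomogeneous.sum _ _ _ fun d hd => ?_
  refine MvPolynomial.isWeightedHomogeneous_monomial _ _ _ ?_
  rw [Finsupp.weight_single, hw p q d (Polynomial.mem_support_iff.mp hd)]

/-- `∏_{i ∈ l} M_i(X_i)` is weighted. [folklore] -/
theorem prodPolyMat_isWtMatrix (P : ι → n → n → k[X]) (l : List ι)
    (hw : ∀ i ∈ l, ∀ p q d, (P i p q).coeff d ≠ 0 → d • w i = e p - e q) :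
    IsWtMatrix w e (prodPolyMat P l) :=
  IsWtMatrix.list_prod fun F hF => by
    obtain ⟨i, hi, rfl⟩ := List.mem_map.mp hF
    exact matAt_isWtMatrix P i (hw i hi)

end Weighted

/-! ### Linear coefficients of the product -/

section Linear

variable {k : Type*} [Field k] {ι : Type*} {n : Type*} [Fintype n] [DecidableEq n]

/-- The coefficient of `X_j` in `F` is the constant coefficient of `∂_j F`. [folklore] -/
theorem coeff_single_one_eq_constantCoeff_pderiv [DecidableEq ι] (F : MvPolynomial ι k) (j : ι) :
    F.coeff (Finsupp.single j 1) = MvPolynomial.constantCoeff (MvPolynomial.pderiv j F) := by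
  induction F using MvPolynomial.induction_on' with
  | monomial m a =>
    rw [MvPolynomial.coeff_monomial, MvPolynomial.pderiv_monomial,
      MvPolynomial.constantCoeff_monomial]
    by_cases hm : m = Finsupp.single j 1
    · subst hm
      simp
    · rw [if_neg hm]
      split_ifs with h0
      · -- `m ≤ single j 1` but `m ≠ single j 1`, so `m j = 0`
        have hle : ∀ i, m i ≤ (Finsupp.single j 1 : ι →₀ ℕ) i := fun i => by
          have := DFunLike.congr_fun h0 i
          rw [Finsupp.coe_tsub, Pi.sub_apply, Finsupp.coe_zero, Pi.zero_apply] at this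
          exact Nat.sub_eq_zero_iff_le.mp this
        have hj : m j = 0 := by
          rcases Nat.le_one_iff_eq_zero_or_eq_one.mp (by simpa using hle j) with h | h
          · exact h
          · exfalso
            apply hm
            ext i
            by_cases hij : i = j
            · subst hij; simp [h]
            · have := hle i
              rw [Finsupp.single_eq_of_ne hij] at this
              rw [Finsupp.single_eq_of_ne hij]
              omega
        simp [hj]
      · rfl
  | add p q hp hq => rw [MvPolynomial.coeff_add, map_add, map_add, hp, hq]

omit [Fintype n] in
/-- The constant coefficients of `M_i(X_i)` form the identity matrix when `M_i(0) = 1`.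
[folklore] -/
theorem matAt_map_constantCoeff (P : ι → n → n → k[X]) (i : ι)
    (h0 : ∀ p q, (P i p q).coeff 0 = (1 : Matrix n n k) p q) :
    (matAt P i).map MvPolynomial.constantCoeff = 1 := by
  ext p q
  rw [Matrix.map_apply, matAt, Matrix.of_apply, constantCoeff_toMvPolynomial, h0]

/-- The constant coefficients of `∏ M_i(X_i)` form the identity matrix. [folklore] -/
theorem prodPolyMat_map_constantCoeff (P : ι → n → n → k[X]) (l : List ι)
    (h0 : ∀ i ∈ l, ∀ p q, (P i p q).coeff 0 = (1 : Matrix n n k) p q) :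
    (prodPolyMat P l).map MvPolynomial.constantCoeff = 1 := by
  induction l with
  | nil => rw [prodPolyMat_nil, Matrix.map_one _ (map_zero _) (map_one _)]
  | cons i l ih =>
    rw [prodPolyMat_cons, Matrix.map_mul, matAt_map_constantCoeff P i (h0 i (by simp)),
      ih fun i' hi' => h0 i' (by simp [hi']), Matrix.one_mul]

omit [DecidableEq n] in
/-- Leibniz rule for the entrywise partial derivative of a product of matrices. [folklore] -/
theorem map_pderiv_mul (j : ι) (F G : Matrix n n (MvPolynomial ι k)) :
    (F * G).map (MvPolynomial.pderiv j) =
      F.map (MvPolynomial.pderiv j) * G + F * G.map (MvPolynomial.pderiv j) := by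
  ext p q
  simp only [Matrix.map_apply, Matrix.mul_apply, Matrix.add_apply, map_sum,
    MvPolynomial.pderiv_mul, Finset.sum_add_distrib]

omit [Fintype n] [DecidableEq n] in
/-- The constant coefficients of `∂_j M_i(X_i)`: the linear coefficients of `P j` if `i = j`,
zero otherwise. [folklore] -/
theorem matAt_map_pderiv_map_constantCoeff [DecidableEq ι] (P : ι → n → n → k[X]) (i j : ι) :
    ((matAt P i).map (MvPolynomial.pderiv j)).map MvPolynomial.constantCoeff =
      if i = j then Matrix.of (fun p q => (P j p q).coeff 1) else 0 := by
  ext p q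
  rw [Matrix.map_apply, Matrix.map_apply, matAt, Matrix.of_apply, pderiv_toMvPolynomial]
  split_ifs with h
  · subst h
    rw [constantCoeff_toMvPolynomial, Polynomial.coeff_derivative, Matrix.of_apply]
    simp
  · rw [map_zero, Matrix.zero_apply]

/-- **The linear coefficients of `∏_{i ∈ l} M_i(X_i)`** (no repetitions in `l`, `M_i(0) = 1`):
the constant coefficients of `∂_j ∏ M_i(X_i)` are the linear coefficients of `M_j` if `j ∈ l`,
and zero otherwise. [folklore] -/
theorem prodPolyMat_map_pderiv_map_constantCoeff [DecidableEq ι] (P : ι → n → n → k[X])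
    (l : List ι) (hl : l.Nodup) (h0 : ∀ i ∈ l, ∀ p q, (P i p q).coeff 0 = (1 : Matrix n n k) p q)
    (j : ι) :
    ((prodPolyMat P l).map (MvPolynomial.pderiv j)).map MvPolynomial.constantCoeff =
      if j ∈ l then Matrix.of (fun p q => (P j p q).coeff 1) else 0 := by
  induction l with
  | nil =>
    rw [prodPolyMat_nil, if_neg (List.not_mem_nil)]
    ext p q
    simp only [Matrix.map_apply, Matrix.zero_apply, Matrix.one_apply]
    split_ifs <;> simp
  | cons i l ih =>
    obtain ⟨hil, hl'⟩ := List.nodup_cons.mp hl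
    have h0' : ∀ i' ∈ l, ∀ p q, (P i' p q).coeff 0 = (1 : Matrix n n k) p q :=
      fun i' hi' => h0 i' (by simp [hi'])
    rw [prodPolyMat_cons, map_pderiv_mul,
      Matrix.map_add _ (map_add (MvPolynomial.constantCoeff (σ := ι) (R := k))),
      Matrix.map_mul, Matrix.map_mul,
      matAt_map_pderiv_map_constantCoeff, prodPolyMat_map_constantCoeff P l h0',
      matAt_map_constantCoeff P i (h0 i (by simp)), ih hl' h0', Matrix.mul_one, Matrix.one_mul]
    by_cases hij : i = j
    · subst hij
      rw [if_pos rfl, if_neg hil, if_pos (List.mem_cons_self), add_zero]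
    · rw [if_neg hij, zero_add]
      by_cases hj : j ∈ l
      · rw [if_pos hj, if_pos (List.mem_cons_of_mem i hj)]
      · rw [if_neg hj, if_neg]
        simp [hj, Ne.symm hij]

/-- The coefficient of `X_j` in the `(p, q)` entry of `∏_{i ∈ l} M_i(X_i)` is the linear
coefficient of the `(p, q)` entry of `M_j`, for `j ∈ l` (no repetitions). [folklore] -/
theorem coeff_single_one_prodPolyMat [DecidableEq ι] (P : ι → n → n → k[X]) (l : List ι)
    (hl : l.Nodup) (h0 : ∀ i ∈ l, ∀ p q, (P i p q).coeff 0 = (1 : Matrix n n k) p q) {j : ι}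
    (hj : j ∈ l) (p q : n) :
    (prodPolyMat P l p q).coeff (Finsupp.single j 1) = (P j p q).coeff 1 := by
  have h := congr_fun (congr_fun (prodPolyMat_map_pderiv_map_constantCoeff P l hl h0 j) p) q
  rw [if_pos hj, Matrix.map_apply, Matrix.map_apply, Matrix.of_apply] at h
  rw [coeff_single_one_eq_constantCoeff_pderiv, h]

end Linear

/-! ### The polynomial retraction -/

section Main

variable {k : Type*} [Field k] {ι : Type*} {n : Type*} [Fintype n] [DecidableEq n]
variable {Λ : Type*} [AddCommGroup Λ]

/-- Pigeonhole on a sum of positive integers: if one term is at least the total, it is the only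
term. [folklore] -/
theorem finset_eq_singleton_of_sum_le {s : Finset ι} {t : ι → ℤ} (ht : ∀ i ∈ s, 0 < t i) {i₀ : ι}
    (hi₀ : i₀ ∈ s) (hle : ∑ i ∈ s, t i ≤ t i₀) : s = {i₀} := by
  classical
  have hsplit := Finset.add_sum_erase s t hi₀
  have hrest : ∑ i ∈ s.erase i₀, t i ≤ 0 := by linarith
  rcases (s.erase i₀).eq_empty_or_nonempty with h | h
  · rcases (Finset.erase_eq_empty_iff s i₀).mp h with h' | h'
    · subst h'; exact absurd hi₀ (Finset.notMem_empty _)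
    · exact h'
  · have hpos : 0 < ∑ i ∈ s.erase i₀, t i :=
      Finset.sum_pos (fun i hi => ht i (Finset.mem_of_mem_erase hi)) h
    exact absurd hrest (not_le.mpr hpos)

/-- **Polynomial left inverse of an ordered product of one-parameter families.** Let
`M_i(x) = 1 + x A_{i,1} + x² A_{i,2} + ⋯` (`i ∈ l`, no repetitions) be matrix-valued polynomial
maps such that the `(p, q)` entry of `A_{i,d}` vanishes unless `e_p - e_q = d · w_i` (weights
`w_i` of the parameters and `e_p` of the coordinates in an abelian group `Λ`), the linear terms
`A_{i,1}` are non-zero, the `w_i` are pairwise distinct and positive for an additive height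
`Λ → ℤ`. Then each parameter `x_j` is a polynomial `Q_j` in the entries of the product
`∏_{i ∈ l} M_i(x_i)`: by induction on the height of `w_j`, the `(p₀, q₀)` entry of the product
(where `(A_{j,1})_{p₀ q₀} ≠ 0`) is `(A_{j,1})_{p₀q₀} x_j` plus monomials in parameters of strictly
smaller height (weighted homogeneity). This is the injectivity-with-regular-inverse half of
Springer 8.2.1 in coordinates. [folklore] -/
theorem exists_mvPolynomial_retraction [DecidableEq ι] (P : ι → n → n → k[X]) (l : List ι)
    (hl : l.Nodup) (w : ι → Λ) (e : n → Λ)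
    (hw : ∀ i ∈ l, ∀ p q d, (P i p q).coeff d ≠ 0 → d • w i = e p - e q)
    (h0 : ∀ i ∈ l, ∀ p q, (P i p q).coeff 0 = (1 : Matrix n n k) p q)
    (h1 : ∀ i ∈ l, ∃ pq : n × n, (P i pq.1 pq.2).coeff 1 ≠ 0)
    (hinj : ∀ i ∈ l, ∀ i' ∈ l, w i = w i' → i = i')
    (hgt : Λ →+ ℤ) (hpos : ∀ i ∈ l, 0 < hgt (w i)) :
    ∃ Q : ι → MvPolynomial (n × n) k, ∀ j ∈ l, ∀ x : ι → k,
      MvPolynomial.eval (fun pq : n × n => prodMat P l x pq.1 pq.2) (Q j) = x j := by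
  -- by induction on the height `H`
  suffices key : ∀ H : ℕ, ∃ Q : ι → MvPolynomial (n × n) k, ∀ j ∈ l, hgt (w j) ≤ H →
      ∀ x : ι → k, MvPolynomial.eval (fun pq : n × n => prodMat P l x pq.1 pq.2) (Q j) = x j by
    obtain ⟨Q, hQ⟩ := key (l.map fun i => (hgt (w i)).toNat).sum
    refine ⟨Q, fun j hj x => hQ j hj ?_ x⟩
    have h1 : (hgt (w j)).toNat ≤ (l.map fun i => (hgt (w i)).toNat).sum :=
      List.le_sum_of_mem (List.mem_map.mpr ⟨j, hj, rfl⟩)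
    have h2 : hgt (w j) ≤ ((hgt (w j)).toNat : ℤ) := Int.self_le_toNat _
    omega
  intro H
  induction H with
  | zero =>
    exact ⟨0, fun j hj hle => absurd (hpos j hj) (not_lt.mpr (by exact_mod_cast hle))⟩
  | succ H ih =>
    obtain ⟨Q, hQ⟩ := ih
    -- the weighted structure of the product
    have hwt := prodPolyMat_isWtMatrix (w := w) (e := e) P l hw
    -- the new polynomials, for the indices of height exactly `H + 1`
    have hnew : ∀ j ∈ l, hgt (w j) = H + 1 → ∃ Qj : MvPolynomial (n × n) k, ∀ x : ι → k,
        MvPolynomial.eval (fun pq : n × n => prodMat P l x pq.1 pq.2) Qj = x j := by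
      intro j hj hH
      obtain ⟨⟨p₀, q₀⟩, ha⟩ := h1 j hj
      set a : k := (P j p₀ q₀).coeff 1 with ha_def
      set F : MvPolynomial ι k := prodPolyMat P l p₀ q₀ with hF
      set F₀ : MvPolynomial ι k := F - MvPolynomial.C a * MvPolynomial.X j with hF₀
      -- the variables of `F₀` have height `≤ H`
      have hvars : ∀ i ∈ F₀.vars, i ∈ l ∧ hgt (w i) ≤ H := by
        intro i hi
        obtain ⟨m, hm, him⟩ := (MvPolynomial.mem_vars_iff_mem_support (i := i)).mp hi
        have hmF₀ : F₀.coeff m ≠ 0 := MvPolynomial.mem_support_iff.mp hm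
        -- `m ≠ X_j` and `coeff m F ≠ 0`
        have hmne : m ≠ Finsupp.single j 1 := by
          intro hmj
          apply hmF₀
          rw [hF₀, MvPolynomial.coeff_sub, MvPolynomial.coeff_C_mul, MvPolynomial.coeff_X, hmj,
            if_pos rfl, mul_one, hF, coeff_single_one_prodPolyMat P l hl h0 hj, sub_self]
        have hmF : F.coeff m ≠ 0 := by
          rwa [hF₀, MvPolynomial.coeff_sub, MvPolynomial.coeff_C_mul, MvPolynomial.coeff_X,
            if_neg (Ne.symm hmne), mul_zero, sub_zero] at hmF₀
        -- all variables of `m` are in `l`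
        have hsupp : ∀ i' ∈ m.support, i' ∈ l := fun i' hi' =>
          List.mem_toFinset.mp (vars_prodPolyMat_subset P l p₀ q₀
            ((MvPolynomial.mem_vars_iff_mem_support (i := i')).mpr
              ⟨m, MvPolynomial.mem_support_iff.mpr hmF, hi'⟩))
        -- weight of `m`
        have hweight : Finsupp.weight w m = w j := by
          rw [hwt p₀ q₀ hmF, ← hw j hj p₀ q₀ 1 ha, one_smul]
        have hsum : ∑ i' ∈ m.support, (m i' : ℤ) * hgt (w i') = H + 1 := by
          have := congrArg hgt hweight
          rw [Finsupp.weight_apply, Finsupp.sum, map_sum] at this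
          rw [← hH, ← this]
          refine Finset.sum_congr rfl fun i' _ => ?_
          rw [map_nsmul, nsmul_eq_mul]
        have hterm : ∀ i' ∈ m.support, 0 < (m i' : ℤ) * hgt (w i') := fun i' hi' =>
          mul_pos (by exact_mod_cast Nat.pos_of_ne_zero (Finsupp.mem_support_iff.mp hi'))
            (hpos i' (hsupp i' hi'))
        refine ⟨hsupp i him, ?_⟩
        by_contra hgtH
        have hge : (H : ℤ) + 1 ≤ hgt (w i) := by omega
        have hmi : (1 : ℤ) ≤ m i := by
          exact_mod_cast Nat.pos_of_ne_zero (Finsupp.mem_support_iff.mp him)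
        -- the term of `i` is at least the total: `m.support = {i}`
        have hle : ∑ i' ∈ m.support, (m i' : ℤ) * hgt (w i') ≤ (m i : ℤ) * hgt (w i) := by
          rw [hsum]
          calc (H : ℤ) + 1 ≤ 1 * hgt (w i) := by rw [one_mul]; exact hge
            _ ≤ (m i : ℤ) * hgt (w i) := mul_le_mul_of_nonneg_right hmi (by omega)
        have hsingle := finset_eq_singleton_of_sum_le hterm him hle
        -- hence `m i = 1` and `m = X_i`
        have hmi1 : m i = 1 := by
          rw [hsingle, Finset.sum_singleton] at hsum
          have h2 : (2 : ℤ) * hgt (w i) ≤ (m i : ℤ) * hgt (w i) ∨ (m i : ℤ) = 1 := by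
            rcases lt_or_ge (m i : ℤ) 2 with h | h
            · right; omega
            · left; exact mul_le_mul_of_nonneg_right h (by omega)
          rcases h2 with h | h
          · exfalso
            have : (m i : ℤ) * hgt (w i) = H + 1 := hsum
            nlinarith
          · exact_mod_cast h
        have hm : m = Finsupp.single i 1 := by
          have := (Finsupp.support_eq_singleton.mp hsingle).2
          rwa [hmi1] at this
        -- so `w i = w j`, `i = j`: contradiction
        rw [hm, Finsupp.weight_single, one_smul] at hweight
        exact hmne (by rw [hm, hinj i (hsupp i him) j hj hweight])
      -- the polynomial
      refine ⟨MvPolynomial.C a⁻¹ * (MvPolynomial.X (p₀, q₀) - MvPolynomial.bind₁ Q F₀), fun x => ?_⟩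
      have hF₀eval : MvPolynomial.eval (fun i => MvPolynomial.eval
          (fun pq : n × n => prodMat P l x pq.1 pq.2) (Q i)) F₀ = MvPolynomial.eval x F₀ := by
        refine MvPolynomial.eval₂Hom_congr' rfl (fun i hi _ => ?_) rfl
        obtain ⟨hil, hiH⟩ := hvars i hi
        exact hQ i hil hiH x
      have hFx : MvPolynomial.eval x F = a * x j + MvPolynomial.eval x F₀ := by
        rw [hF₀, map_sub, map_mul, MvPolynomial.eval_C, MvPolynomial.eval_X]
        ring
      rw [map_mul, MvPolynomial.eval_C, map_sub, MvPolynomial.eval_X, eval_bind₁, hF₀eval,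
        ← eval_prodPolyMat, ← hF, hFx]
      field_simp
      ring
    -- assemble
    classical
    refine ⟨fun j => if h : j ∈ l ∧ hgt (w j) = H + 1 then (hnew j h.1 h.2).choose else Q j,
      fun j hj hle x => ?_⟩
    by_cases h : j ∈ l ∧ hgt (w j) = H + 1
    · simp only [dif_pos h]
      exact (hnew j h.1 h.2).choose_spec x
    · simp only [dif_neg h]
      refine hQ j hj ?_ x
      have : hgt (w j) ≠ H + 1 := fun h' => h ⟨hj, h'⟩
      push_cast at hle
      omega

end Main

/-! ### One-parameter matrix groups in characteristic zero: the linear term is non-zero -/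

section CharZero

variable {k : Type*} [Field k] {n : Type*} [Fintype n] [DecidableEq n]

/-- Rescaling identity on coefficients: if `p(a x) = b p(x)` for all `x` (over an infinite field)
and the coefficient of `X^d` in `p` is non-zero, then `a^d = b`. [folklore] -/
theorem pow_eq_of_eval_mul_eq [Infinite k] (p : k[X]) {a b : k}
    (hp : ∀ x : k, p.eval (a * x) = b * p.eval x) {d : ℕ} (hd : p.coeff d ≠ 0) : a ^ d = b := by
  have hpoly : p.comp (Polynomial.C a * Polynomial.X) = Polynomial.C b * p :=
      Polynomial.funext fun x => by
    rw [Polynomial.eval_comp, Polynomial.eval_mul, Polynomial.eval_C, Polynomial.eval_X,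
      Polynomial.eval_mul, Polynomial.eval_C]
    exact hp x
  have hcoeff := congrArg (fun q => q.coeff d) hpoly
  simp only [Polynomial.comp_C_mul_X_coeff, Polynomial.coeff_C_mul] at hcoeff
  exact mul_left_cancel₀ hd (hcoeff.trans (mul_comm _ _))

/-- **In characteristic `0` a non-trivial polynomial one-parameter matrix group has a non-zero
linear term.** Let `M(x)` be matrices with polynomial entries `P p q`, with `M(0) = 1` and
`M(2x) = M(x)²` (as holds for a homomorphism `𝔾ₐ → GL_n`). If all linear coefficients vanish,
then all coefficients of positive degree vanish: comparing coefficients of `X^d` gives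
`(2^d - 2) A_d = ∑_{0<c<d} A_c A_{d-c}` (so `M(x) = exp(x A_1)`). [folklore] -/
theorem coeff_eq_zero_of_coeff_one_eq_zero [CharZero k] (P : n → n → k[X])
    (h0 : ∀ p q, (P p q).coeff 0 = (1 : Matrix n n k) p q)
    (h2 : ∀ (x : k) (p q : n), (P p q).eval (2 * x) = ∑ r, (P p r).eval x * (P r q).eval x)
    (h1 : ∀ p q, (P p q).coeff 1 = 0) {d : ℕ} (hd : 0 < d) (p q : n) : (P p q).coeff d = 0 := by
  haveI : Infinite k := by
    -- a field of characteristic zero is infinite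
    exact Infinite.of_injective (fun m : ℕ => (m : k)) Nat.cast_injective
  induction d using Nat.strong_induction_on generalizing p q with
  | _ d ih =>
    rcases Nat.lt_or_ge d 2 with hd2 | hd2
    · obtain rfl : d = 1 := by omega
      exact h1 p q
    -- the polynomial identity `P p q (2 X) = ∑_r P p r * P r q`
    have hpoly : (P p q).comp (Polynomial.C 2 * Polynomial.X) = ∑ r, P p r * P r q :=
        Polynomial.funext fun x => by
      rw [Polynomial.eval_comp, Polynomial.eval_mul, Polynomial.eval_C, Polynomial.eval_X,
        Polynomial.eval_finsetSum]
      simp only [Polynomial.eval_mul]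
      exact h2 x p q
    have hcoeff := congrArg (fun f => f.coeff d) hpoly
    simp only [Polynomial.comp_C_mul_X_coeff, Polynomial.finsetSum_coeff, Polynomial.coeff_mul]
      at hcoeff
    -- each antidiagonal sum has only the two extreme terms
    have hanti : ∀ r, ∑ x ∈ Finset.antidiagonal d, (P p r).coeff x.1 * (P r q).coeff x.2 =
        (P p r).coeff 0 * (P r q).coeff d + (P p r).coeff d * (P r q).coeff 0 := by
      intro r
      rw [Finset.sum_eq_add_of_mem (0, d) (d, 0) (by simp) (by simp) (by simp; omega)]
      rintro ⟨c, c'⟩ hc ⟨hne1, hne2⟩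
      rw [Finset.mem_antidiagonal] at hc
      simp only [ne_eq, Prod.mk.injEq, not_and] at hne1 hne2
      have hc0 : c ≠ 0 := fun h => hne1 h (by omega)
      have hcd : c < d := by
        rcases Nat.lt_or_ge c d with h | h
        · exact h
        · exfalso; exact hne2 (by omega) (by omega)
      rw [ih c hcd (Nat.pos_of_ne_zero hc0) p r, zero_mul]
    simp only [hanti, Finset.sum_add_distrib, h0] at hcoeff
    rw [Finset.sum_eq_single p (fun r _ hr => by rw [Matrix.one_apply_ne' hr, zero_mul])
      (fun h => absurd (Finset.mem_univ p) h),
      Finset.sum_eq_single q (fun r _ hr => by rw [Matrix.one_apply_ne hr, mul_zero])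
      (fun h => absurd (Finset.mem_univ q) h), Matrix.one_apply_eq, Matrix.one_apply_eq,
      one_mul, mul_one, ← two_mul] at hcoeff
    -- `(2^d - 2) a = 0` with `2^d ≠ 2`
    have h22 : ((2 : k) ^ d - 2) ≠ 0 := by
      have : (2 : ℕ) ^ d ≠ 2 := by
        have : 2 ^ 2 ≤ 2 ^ d := Nat.pow_le_pow_right (by norm_num) hd2
        omega
      intro h
      apply this
      have h' : ((2 ^ d : ℕ) : k) = ((2 : ℕ) : k) := by push_cast; exact sub_eq_zero.mp h
      exact Nat.cast_injective h'
    have : ((2 : k) ^ d - 2) * (P p q).coeff d = 0 := by rw [sub_mul, mul_comm, hcoeff, sub_self]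
    exact (mul_eq_zero.mp this).resolve_left h22

end CharZero

/-! ### Application to root homomorphisms -/

section RootHoms

variable {k : Type*} [Field k] {n : Type*} [Fintype n] [DecidableEq n]
variable {ι X Y : Type*} [AddCommGroup X] [AddCommGroup Y]
variable {G T : Subgroup (GL n k)} [IsMulCommutative ↥T]

omit [IsMulCommutative ↥T] in
/-- `⟨1, λ⟩ = 0` (companion to `charPairingInt_mul_left` of `ReductiveDualRootDatum.lean`;
Springer 3.2.11 (i)). [folklore] -/
theorem charPairingInt_one_left [Infinite k] {γ : kˣ →* ↥T} (hγ : IsAlgebraicCochar γ) :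
    charPairingInt (1 : ↥T →* kˣ) γ = 0 := by
  apply zpowGroupHom_units_injective (k := k)
  ext x
  simp only [zpowGroupHom_apply]
  rw [← charPairingInt_spec_holds IsAlgebraicChar.one hγ x, zpow_zero, MonoidHom.one_apply]

omit [IsMulCommutative ↥T] in
/-- `A t A⁻¹` is diagonal with entries the coordinate characters, for `A` diagonalising `T`.
[folklore] -/
theorem conj_torus_eq_diagonal (A : GL n k)
    (hA : T.map (MulAut.conj A : GL n k →* GL n k) ≤ diagonalSubgroup n k) (t : ↥T) :
    ((A * (t : GL n k) * A⁻¹ : GL n k) : Matrix n n k) =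
      Matrix.diagonal fun p => ((diagEntryChar hA p (conjEquiv A T t) : kˣ) : k) := by
  rw [← coe_conjEquiv_apply]
  ext p q
  rw [coe_apply_diagCoord hA, Matrix.diagonal_apply]
  rfl

omit [IsMulCommutative ↥T] in
/-- `A t⁻¹ A⁻¹` is diagonal with the inverse entries. [folklore] -/
theorem conj_torus_inv_eq_diagonal (A : GL n k)
    (hA : T.map (MulAut.conj A : GL n k →* GL n k) ≤ diagonalSubgroup n k) (t : ↥T) :
    ((A * ((t⁻¹ : ↥T) : GL n k) * A⁻¹ : GL n k) : Matrix n n k) =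
      Matrix.diagonal fun p => (((diagEntryChar hA p (conjEquiv A T t) : kˣ) : k))⁻¹ := by
  rw [conj_torus_eq_diagonal A hA t⁻¹]
  congr 1
  funext p
  rw [map_inv, map_inv, Units.val_inv_eq_inv_val]

/-- **The polynomial left inverse of an ordered product of root homomorphisms** (the
injectivity half of Springer 8.2.1, proved in coordinates). Let `T ≤ G ≤ GL_n` with `T` a torus
over an algebraically closed field of characteristic `0`, `P` a root datum of `(G, T)` with root
homomorphisms `u_i`, and `(α_i)_{i ∈ l}` distinct roots all positive on a coweight `y`. Then
there are polynomials `q_i` in the matrix coordinates with `q_i(∏_{j ∈ l} u_j(x_j)) = x_i` for all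
`x` and `i ∈ l`. Proof: diagonalise `T` by `A`; the entries of `A u_i(x) A⁻¹` are polynomials in
`x` whose `X^d`-coefficients have `T`-weight `α_i^d` (torus relation), with non-zero linear term
(characteristic `0` and injectivity of `u_i`, `coeff_eq_zero_of_coeff_one_eq_zero`); conclude by
`exists_mvPolynomial_retraction` with the height `⟨·, y⟩`. [cite: SpringerLAG1998, 8.2.1] -/
theorem exists_polyRetraction_prod_rootHom [IsAlgClosed k] [CharZero k] (hT : IsTorusSubgroup T)
    {P : RootPairing ι ℤ X Y} {eX : Additive ↥(characterLattice T) ≃+ X}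
    {eY : Additive ↥(cocharacterLattice T) ≃+ Y} (h : IsRootDatumOf G T P eX eY)
    (u : ι → Multiplicative k →* ↥G)
    (hu : ∀ i, IsRootHom G T h.le (charOfWeight eX (P.root i)) (u i))
    (y : Y) (l : List ι) (hl : l.Nodup) (hl' : ∀ i ∈ l, 0 < P.root' i y) :
    ∃ q : ι → MvPolynomial (GLCoord n) k, ∀ (x : ι → k), ∀ i ∈ l,
      MvPolynomial.eval (glCoordFun
        (l.map fun i => ((u i (Multiplicative.ofAdd (x i)) : ↥G) : GL n k)).prod) (q i) = x i := by
  classical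
  obtain ⟨A, hA⟩ := exists_conj_le_diagonalSubgroup hT.2.1 hT.2.2
  have hA' : T.map (MulAut.conj A : GL n k →* GL n k) ≤ diagonalSubgroup n k := hA
  set γ : kˣ →* ↥T := cocharOfCoweight eY y with hγdef
  have hγ : IsAlgebraicCochar γ := (Additive.toMul (eY.symm y)).2
  have halg : ∀ i, IsAlgebraicChar (charOfWeight eX (P.root i)) := fun i =>
    (Additive.toMul (eX.symm (P.root i))).2
  have hpair : ∀ i, charPairingInt (charOfWeight eX (P.root i)) γ = P.root' i y := by
    intro i
    have e := h.pairing_eq (Additive.toMul (eX.symm (P.root i))) (Additive.toMul (eY.symm y))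
    simp only [ofMul_toMul, AddEquiv.apply_symm_apply] at e
    exact e.symm
  -- polynomial entries of the conjugated root homomorphisms
  choose Pc hPc using fun i => (hu i).1.exists_polynomial_conj A
  -- the coordinate characters, the weights and the height
  set χ : n → ↥(characterLattice T) := fun p =>
    ⟨(diagEntryChar hA' p).comp (conjEquiv A T).toMonoidHom,
      (isAlgebraicChar_diagEntryChar hA' p).comp_conjEquiv A⟩ with hχ
  set e : n → Additive ↥(characterLattice T) := fun p => Additive.ofMul (χ p) with he
  set w : ι → Additive ↥(characterLattice T) := fun i => eX.symm (P.root i) with hw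
  let hgt : Additive ↥(characterLattice T) →+ ℤ :=
    { toFun := fun c => charPairingInt ((Additive.toMul c : ↥(characterLattice T)) : ↥T →* kˣ) γ
      map_zero' := charPairingInt_one_left hγ
      map_add' := fun c c' =>
        charPairingInt_mul_left (Additive.toMul c).2 (Additive.toMul c').2 hγ }
  -- torus relation, conjugated: weights of the coefficients
  have hconj : ∀ (i : ι) (t : ↥T) (x : k) (p q : n),
      ((χ p : ↥T →* kˣ) t : k) * (Pc i p q).eval x * (((χ q : ↥T →* kˣ) t : k))⁻¹ =
        (Pc i p q).eval (((charOfWeight eX (P.root i) t : kˣ) : k) * x) := by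
    intro i t x p q
    have key : (A * ((t : ↥T) : GL n k) * A⁻¹) *
        (A * ((u i (Multiplicative.ofAdd x) : ↥G) : GL n k) * A⁻¹) *
        (A * ((t⁻¹ : ↥T) : GL n k) * A⁻¹) =
          A * ((u i (Multiplicative.ofAdd (((charOfWeight eX (P.root i) t : kˣ) : k) * x)) : ↥G) :
            GL n k) * A⁻¹ := by
      have h3 := congrArg (fun g : ↥G => (g : GL n k)) ((hu i).2.2 t x)
      simp only [Subgroup.coe_mul, Subgroup.coe_inv, Subgroup.coe_inclusion] at h3
      rw [← h3, Subgroup.coe_inv]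
      group
    have kmat : ((A * ((t : ↥T) : GL n k) * A⁻¹ : GL n k) : Matrix n n k) *
        ((A * ((u i (Multiplicative.ofAdd x) : ↥G) : GL n k) * A⁻¹ : GL n k) : Matrix n n k) *
        ((A * ((t⁻¹ : ↥T) : GL n k) * A⁻¹ : GL n k) : Matrix n n k) =
          ((A * ((u i (Multiplicative.ofAdd (((charOfWeight eX (P.root i) t : kˣ) : k) * x)) :
            ↥G) : GL n k) * A⁻¹ : GL n k) : Matrix n n k) := by
      rw [← Units.val_mul, ← Units.val_mul, key]
    rw [conj_torus_eq_diagonal A hA' t, conj_torus_inv_eq_diagonal A hA' t] at kmat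
    have kij := congr_fun (congr_fun kmat p) q
    rw [Matrix.mul_diagonal, Matrix.diagonal_mul, hPc, hPc] at kij
    exact kij
  have hwt : ∀ i ∈ l, ∀ p q d, (Pc i p q).coeff d ≠ 0 → d • w i = e p - e q := by
    intro i _ p q d hd
    -- `(α_i t)^d = χ_p t / χ_q t` for all `t`
    have hpow : ∀ t : ↥T, ((charOfWeight eX (P.root i) t : kˣ) : k) ^ d =
        ((χ p : ↥T →* kˣ) t : k) * (((χ q : ↥T →* kˣ) t : k))⁻¹ := fun t =>
      pow_eq_of_eval_mul_eq (Pc i p q) (fun x => by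
        rw [← hconj i t x p q]; ring) hd
    -- as an identity in the character lattice
    have hmul : (Additive.toMul (w i)) ^ d = χ p * (χ q)⁻¹ := by
      apply Subtype.ext
      ext t
      have h1 : (((Additive.toMul (w i) ^ d : ↥(characterLattice T)) : ↥T →* kˣ) t : k) =
          ((charOfWeight eX (P.root i) t : kˣ) : k) ^ d := by
        rw [SubmonoidClass.coe_pow, MonoidHom.pow_apply, Units.val_pow_eq_pow_val]
        rfl
      rw [h1, hpow t, Subgroup.coe_mul, Subgroup.coe_inv, MonoidHom.mul_apply,
        MonoidHom.inv_apply, Units.val_mul, Units.val_inv_eq_inv_val]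
    have : d • w i = Additive.ofMul (χ p * (χ q)⁻¹) := by
      rw [← hmul]; rfl
    rw [this, ofMul_mul, ofMul_inv, he, sub_eq_add_neg]
  have h0 : ∀ i ∈ l, ∀ p q, (Pc i p q).coeff 0 = (1 : Matrix n n k) p q := by
    intro i _ p q
    rw [Polynomial.coeff_zero_eq_eval_zero, ← hPc]
    simp
  -- the linear terms are non-zero (characteristic `0`)
  have h1 : ∀ i ∈ l, ∃ pq : n × n, (Pc i pq.1 pq.2).coeff 1 ≠ 0 := by
    intro i hi
    by_contra hall
    have hlin : ∀ p q, (Pc i p q).coeff 1 = 0 := fun p q => by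
      by_contra hne
      exact hall ⟨⟨p, q⟩, hne⟩
    -- `M(2x) = M(x)^2`
    have h2 : ∀ (x : k) (p q : n), (Pc i p q).eval (2 * x) =
        ∑ r, (Pc i p r).eval x * (Pc i r q).eval x := by
      intro x p q
      have hh : (A * ((u i (Multiplicative.ofAdd (2 * x)) : ↥G) : GL n k) * A⁻¹ : GL n k) =
          (A * ((u i (Multiplicative.ofAdd x) : ↥G) : GL n k) * A⁻¹) *
            (A * ((u i (Multiplicative.ofAdd x) : ↥G) : GL n k) * A⁻¹) := by
        rw [two_mul, ofAdd_add, map_mul, Subgroup.coe_mul]; group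
      have hm := congrArg (fun g : GL n k => (g : Matrix n n k) p q) hh
      simp only [Units.val_mul] at hm
      rw [← Units.val_mul, ← Units.val_mul, hPc, Matrix.mul_apply] at hm
      rw [hm]
      refine Finset.sum_congr rfl fun r _ => ?_
      rw [← Units.val_mul, ← Units.val_mul, hPc, hPc]
    have hzero : ∀ (d : ℕ), 0 < d → ∀ p q, (Pc i p q).coeff d = 0 := fun d hd p q =>
      coeff_eq_zero_of_coeff_one_eq_zero (Pc i) (h0 i hi) h2 hlin hd p q
    -- hence `u i x = 1` for all `x`
    have htriv : ∀ x : k, ((u i (Multiplicative.ofAdd x) : ↥G) : GL n k) = 1 := by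
      intro x
      have hM : (A * ((u i (Multiplicative.ofAdd x) : ↥G) : GL n k) * A⁻¹ : GL n k) = 1 := by
        refine Units.ext (Matrix.ext fun p q => ?_)
        rw [hPc, Units.val_one, ← h0 i hi p q, Polynomial.coeff_zero_eq_eval_zero]
        -- `Pc i p q` is constant
        have hc : Pc i p q = Polynomial.C ((Pc i p q).coeff 0) := by
          ext d
          rcases d with _ | d
          · simp
          · rw [Polynomial.coeff_C, if_neg (Nat.succ_ne_zero d)]
            exact hzero (d + 1) (Nat.succ_pos d) p q
        rw [hc, Polynomial.eval_C, Polynomial.eval_C]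
      have : ((u i (Multiplicative.ofAdd x) : ↥G) : GL n k) =
          A⁻¹ * (A * (u i (Multiplicative.ofAdd x) : ↥G) * A⁻¹) * A := by group
      rw [this, hM]; group
    obtain ⟨qr, hqr⟩ := (hu i).2.1
    have e1 := hqr 1
    rw [htriv 1, ← htriv 0, hqr 0] at e1
    exact one_ne_zero e1.symm
  have hinj : ∀ i ∈ l, ∀ i' ∈ l, w i = w i' → i = i' := by
    intro i _ i' _ hii'
    exact P.root.injective (eX.symm.injective hii')
  have hpos : ∀ i ∈ l, 0 < hgt (w i) := by
    intro i hi
    change 0 < charPairingInt ((Additive.toMul (eX.symm (P.root i)) : ↥(characterLattice T)) :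
      ↥T →* kˣ) γ
    rw [show ((Additive.toMul (eX.symm (P.root i)) : ↥(characterLattice T)) : ↥T →* kˣ) =
      charOfWeight eX (P.root i) from rfl, hpair]
    exact hl' i hi
  -- the abstract retraction
  obtain ⟨Q, hQ⟩ := exists_mvPolynomial_retraction Pc l hl w e hwt h0 h1 hinj hgt hpos
  -- the product, conjugated by `A`, is `prodMat Pc l x`
  have hprod : ∀ x : ι → k, prodMat Pc l x =
      ((A * (l.map fun i => ((u i (Multiplicative.ofAdd (x i)) : ↥G) : GL n k)).prod * A⁻¹ :
        GL n k) : Matrix n n k) := by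
    intro x
    have hc : A * (l.map fun i => ((u i (Multiplicative.ofAdd (x i)) : ↥G) : GL n k)).prod * A⁻¹ =
        (l.map fun i => A * ((u i (Multiplicative.ofAdd (x i)) : ↥G) : GL n k) * A⁻¹).prod := by
      have := map_list_prod (MulAut.conj A).toMonoidHom
        (l.map fun i => ((u i (Multiplicative.ofAdd (x i)) : ↥G) : GL n k))
      rw [List.map_map] at this
      exact this
    rw [hc, ← Units.coeHom_apply, map_list_prod, List.map_map, prodMat]
    congr 1
    refine List.map_congr_left fun i _ => ?_
    ext p q
    simp only [Function.comp_apply, Matrix.of_apply, Units.coeHom_apply]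
    rw [hPc]
  refine ⟨fun j => MvPolynomial.bind₁ (fun pq : n × n => conjPolyGL A A⁻¹ (Sum.inl pq)) (Q j),
    fun x i hi => ?_⟩
  rw [eval_bind₁]
  have : (fun pq : n × n => MvPolynomial.eval (glCoordFun
      (l.map fun i => ((u i (Multiplicative.ofAdd (x i)) : ↥G) : GL n k)).prod)
        (conjPolyGL A A⁻¹ (Sum.inl pq))) = fun pq : n × n => prodMat Pc l x pq.1 pq.2 := by
    funext pq
    rw [eval_conjPolyGL, glCoordFun_inl, hprod]
  rw [this]
  exact hQ i hi x

end RootHoms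

/-! ### Springer 8.2.1: surjectivity as a named fact, and the combined statement -/

section Facts

variable {k : Type*} [Field k] {n : Type*} [Fintype n] [DecidableEq n]
variable {ι X Y : Type*} [AddCommGroup X] [AddCommGroup Y]
variable (G T : Subgroup (GL n k)) [IsMulCommutative ↥T]

/-- **Springer 8.2.1, surjectivity half, as a named fact**: for `G` connected reductive over an
algebraically closed field of characteristic `0` (Springer: any characteristic), `T` a maximal
torus with root datum `P`, root homomorphisms `u_i`, `y` a regular coweight and `(α_i)_{i ∈ l}`
any numbering of the positive system `R⁺(y)`, every element of `U(y) = ⟨u_i(𝔾ₐ) : i ∈ l⟩`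
(`posRootGroup`; the unipotent radical of the Borel subgroup `B(y) ⊇ T`, 8.2.4 (i), with
`U_{α_i} = u_i(𝔾ₐ)`, 8.1.1 (i)) is an ordered product `∏_{i ∈ l} u_i(x_i)` — "the morphism
`φ : 𝔾ₐ^m → B_u` … is an isomorphism of varieties" (8.2.1), in particular surjective. Together
with the proved injectivity half (`exists_polyRetraction_prod_rootHom`) this gives
`posRootGroup_prodIso` (`posRootGroup_prodIso_of_eq_prod`).
[cite: SpringerLAG1998, 8.2.1 with 8.2.4 (i) and 8.1.1 (i)] -/
def posRootGroup_eq_prod : Prop :=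
  ∀ [IsAlgClosed k] [CharZero k] (_hG : IsConnectedReductive G) (_hT : IsMaximalTorusIn T G)
    {P : RootPairing ι ℤ X Y} {eX : Additive ↥(characterLattice T) ≃+ X}
    {eY : Additive ↥(cocharacterLattice T) ≃+ Y} (h : IsRootDatumOf G T P eX eY)
    (u : ι → Multiplicative k →* ↥G)
    (_hu : ∀ i, IsRootHom G T h.le (charOfWeight eX (P.root i)) (u i))
    (y : Y) (_hy : ∀ i, P.root' i y ≠ 0) (l : List ι) (_hl : l.Nodup)
    (_hl' : ∀ i, i ∈ l ↔ 0 < P.root' i y),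
    ∀ g ∈ posRootGroup G P u y, ∃ x : ι → k,
      g = (l.map fun i => ((u i (Multiplicative.ofAdd (x i)) : ↥G) : GL n k)).prod

variable {G T}

/-- **Springer 8.2.1 (`posRootGroup_prodIso` of `BigCellReduction.lean`) follows from its
surjectivity half** (`posRootGroup_eq_prod`), the injectivity-with-polynomial-inverse half
being the theorem `exists_polyRetraction_prod_rootHom`. [cite: SpringerLAG1998, 8.2.1] -/
theorem posRootGroup_prodIso_of_eq_prod
    (hs : posRootGroup_eq_prod (k := k) (ι := ι) (X := X) (Y := Y) G T) :
    posRootGroup_prodIso (k := k) (ι := ι) (X := X) (Y := Y) G T := by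
  intro _ _ hG hT P eX eY h u hu y hy l hl hl'
  exact ⟨hs hG hT h u hu y hy l hl hl',
    exists_polyRetraction_prod_rootHom hT.2.1 h u hu y l hl fun i hi => (hl' i).mp hi⟩

/-- The open big cell from Springer 8.2.1 (surjectivity half) and 8.3.11.
[cite: SpringerLAG1998, 8.2.1, 8.3.11 and the proof of 9.6.2] -/
theorem nonempty_bigCellChart_of_eq_prod
    (hs : posRootGroup_eq_prod (k := k) (ι := ι) (X := X) (Y := Y) G T)
    (hF2 : bigCell_nhds_one (k := k) (ι := ι) (X := X) (Y := Y) G T) :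
    nonempty_bigCellChart (k := k) (ι := ι) (X := X) (Y := Y) (G := G) (T := T) :=
  nonempty_bigCellChart_of_facts (posRootGroup_prodIso_of_eq_prod hs) hF2

end Facts

end Literature.NumberTheory.Automorphic

/-! ### Consequence for Chevalley's isomorphism theorem -/

namespace Literature.NumberTheory.Automorphic


variable {k : Type*} [Field k]
variable {ι X Y : Type*} [AddCommGroup X] [AddCommGroup Y]
variable {N N' : ℕ} {G T : Subgroup (GL (Fin N) k)} {G' T' : Subgroup (GL (Fin N') k)}
  [IsMulCommutative ↥T] [IsMulCommutative ↥T']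

/-- **`chevalley_isomorphism` from step 1 of Springer's proof, the surjectivity half of 8.2.1,
and 8.3.11.** As `chevalley_isomorphism_of_facts` (`BigCellReduction.lean`), with the named fact
`posRootGroup_prodIso` (8.2.1) replaced by its surjectivity half `posRootGroup_eq_prod`, the
injectivity half being proved here. [cite: SpringerLAG1998, 9.6.2 (proof) with 8.2.1 and 8.3.11] -/
theorem chevalley_isomorphism_of_eq_prod
    (hA : chevalley_isomorphism_abstract (k := k) (ι := ι) (X := X) (Y := Y) (G := G) (T := T)
      (G' := G') (T' := T'))
    (hF1 : posRootGroup_eq_prod (k := k) (ι := ι) (X := X) (Y := Y) G T)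
    (hF2 : bigCell_nhds_one (k := k) (ι := ι) (X := X) (Y := Y) G T)
    (hF1' : posRootGroup_eq_prod (k := k) (ι := ι) (X := X) (Y := Y) G' T')
    (hF2' : bigCell_nhds_one (k := k) (ι := ι) (X := X) (Y := Y) G' T') :
    chevalley_isomorphism (k := k) (ι := ι) (X := X) (Y := Y) (G := G) (T := T) (G' := G')
      (T' := T') :=
  chevalley_isomorphism_of_facts hA (posRootGroup_prodIso_of_eq_prod hF1) hF2
    (posRootGroup_prodIso_of_eq_prod hF1') hF2'

end Literature.NumberTheory.Automorphic

end
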